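import Literature.Analysis.FluidPDE.LatticeShearWords
import Mathlib.Analysis.SpecialFunctions.ExpDeriv
import Mathlib.Analysis.SpecialFunctions.Integrals.Basic
import Mathlib.MeasureTheory.Integral.IntervalIntegral.IntegrationByParts
import Mathlib.MeasureTheory.Integral.IntervalIntegral.FundThmCalculus
import HarnessLib

/-!
# The quasi-statically realised slot weight `ϑ(ρ, T)` of a ramped Kolmogorov layer

When a Kolmogorov shear layer is switched on with a time envelope `a(s)` (the trapezoid of
`Literature.Analysis.FluidPDE.LatticeShear.LatticeWord.trapezoid`: linear ramps of relative length `ρ`),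
the cell corrector of the passive problem — the `±1` side modes of the frequency ladder, damped at rate
`λ` and fed by `a(s)` times the mean mode — is the Duhamel response `J(s) = ∫₀ˢ e^{−λ(s−s′)} a(s′) ds′`,
and the Taylor (second-order) decay it feeds back on the mean mode over the slot is
`∫₀^τ a(s)·J(s) ds` times a fixed geometric constant: the REALISED slot weight is
`ϑ(ρ, T) := (λ/τ)∫₀^τ a J`, `T = λτ`, against the NOMINAL (steady full-amplitude) weight `1`
(docstring of `Literature.Analysis.FluidPDE.LatticeShear.slotGain`; Majda–Kramer 1999 §2.2.1.3 eq. (55):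
for a time-modulated shear the steady temporal modes produce the time-AVERAGED Taylor constant and
the oscillating ones are depleted by the factor `λ²/(λ² + ω²) ≤ 1`; Armstrong–Vicol 2025 carry the same
envelope factor `∫ζ² = 9/10` and the start-up lag `Cε⁴/(κ²τ)`).

This file proves, by elementary calculus (no Fourier transform), the two laws the `ad-ideate` cell's
K2R/K1R bookkeeping consumes (STUB-PLAN r14 §4.1 «kernel lemma»):
* `mul_integral_duhamel_le_integral_sq` — **upper law, any continuous envelope of any sign**:
  `λ∫₀^τ a(s)J(s) ds ≤ ∫₀^τ a(s)² ds` (the kernel `λe^{−λ|u|}1_{u>0}` has symbol of real part `≤ 1`;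
  here: AM–GM inside the kernel and the ODE `G′ = λa² − λG` for `G = λ·J[a²]`);
* `integral_trapezoid_sq` — `∫₀^τ trapezoid² = τ(1 − 4ρ/3)`;
* `mul_integral_trapezoid_duhamel_eq` — **exact identity for the trapezoid**:
  `λ∫₀^τ aJ = τ(1 − 4ρ/3) − (J(ρτ) + J(τ−ρτ) − J(τ))/(ρτλ)` (piecewise integration by parts; the two
  `O(1/λ)` ramp contributions cancel through `∫ a a′ = 0`);
* `abs_mul_integral_trapezoid_duhamel_sub_le` — **two-sided law with explicit lag**:
  `|λ∫₀^τ aJ − τ(1 − 4ρ/3)| ≤ 2/(ρτλ²)`, i.e. `|ϑ(ρ,T) − (1 − 4ρ/3)| ≤ 2/(ρT²)`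
  (`ϑ(½, T) ≥ 1/3 − 4/T²`, `ϑ ≤ 1/3 + 4/T²`, and `ϑ ≤ ⨍a² = 1/3` sharp by the upper law).
* `mul_integral_pair_duhamel_eq` / `abs_mul_integral_pair_duhamel_sub_le` — **a same-direction PAIR
  of slots on one ladder** (STUB-PLAN r14 §4.2 «double hump», envelope
  `c₁·trapezoid(0,τ₁,ρ) + c₂·trapezoid(τ₁,τ₂,ρ)`, real `c_i` of any sign): exact decomposition into
  the two slot integrals plus ONE cross term `c₁c₂·λ·J[a₁](τ₁)·∫₀^{τ₂}a₂e^{−λu}`, both of whose factors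
  are `≤ 1/(ρτ_iλ²)` (`duhamel_trapezoid_end_le`, `integral_trapezoid_mul_exp_neg_le`), whence
  `|λ∫gJ[g] − (c₁²τ₁ + c₂²τ₂)(1 − 4ρ/3)| ≤ 2c₁²/(ρτ₁λ²) + 2c₂²/(ρτ₂λ²) + |c₁c₂|/(ρ²τ₁τ₂λ³)`;
  with `duhamel_eq_exp_mul_of_eq_zero` (free decay after the support) and `trapezoid_shift`.
Also: `hasDerivAt_duhamel` (`J′ = a − λJ`), `duhamel_nonneg`, `duhamel_le` (`0 ≤ J ≤ (1 − e^{−λs})/λ ≤ 1/λ`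
for `0 ≤ a ≤ 1`), and the piecewise formulas / ramp majorants for the trapezoid.

No definitions (the Duhamel response is written out as `exp(−λs)·∫₀ˢ exp(λx)a(x)dx`), no named facts.
-/

noncomputable section

namespace Literature.Analysis.FluidPDE.LatticeShear

open MeasureTheory intervalIntegral Set Real

section Duhamel

/-- The Duhamel response written with the factored kernel: `e^{−λs}∫₀ˢ e^{λx}a(x)dx = ∫₀ˢ e^{−λ(s−x)}a(x)dx`.
[cite: MajdaKramer1999, §2.2.1.3 (55)] -/
theorem exp_mul_integral_eq_duhamel (a : ℝ → ℝ) (lam s : ℝ) :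
    Real.exp (-lam * s) * ∫ x in (0:ℝ)..s, Real.exp (lam * x) * a x
      = ∫ x in (0:ℝ)..s, Real.exp (-lam * (s - x)) * a x := by
  rw [← intervalIntegral.integral_const_mul]
  refine intervalIntegral.integral_congr fun x _ => ?_
  rw [← mul_assoc, ← Real.exp_add]
  congr 1; ring_nf

/-- **The Duhamel response solves `J′ = a − λJ`** (for a continuous envelope).
[cite: MajdaKramer1999, §2.2.1.3 (cell problem (49) with ∂χ/∂t)] -/
theorem hasDerivAt_duhamel {a : ℝ → ℝ} (ha : Continuous a) (lam s : ℝ) :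
    HasDerivAt (fun s => Real.exp (-lam * s) * ∫ x in (0:ℝ)..s, Real.exp (lam * x) * a x)
      (a s - lam * (Real.exp (-lam * s) * ∫ x in (0:ℝ)..s, Real.exp (lam * x) * a x)) s := by
  have hcont : Continuous fun x => Real.exp (lam * x) * a x := by fun_prop
  have h1 : HasDerivAt (fun s => ∫ x in (0:ℝ)..s, Real.exp (lam * x) * a x)
      (Real.exp (lam * s) * a s) s := (hcont.integral_hasStrictDerivAt 0 s).hasDerivAt
  have h2 : HasDerivAt (fun s => Real.exp (-lam * s)) (-lam * Real.exp (-lam * s)) s := by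
    have h := ((hasDerivAt_id s).const_mul (-lam)).exp
    simp only [id, mul_one] at h
    exact h.congr_deriv (by ring)
  have h := h2.mul h1
  refine h.congr_deriv ?_
  have he : Real.exp (-lam * s) * Real.exp (lam * s) = 1 := by
    rw [← Real.exp_add]; simp
  calc -lam * Real.exp (-lam * s) * (∫ x in (0:ℝ)..s, Real.exp (lam * x) * a x)
        + Real.exp (-lam * s) * (Real.exp (lam * s) * a s)
      = (Real.exp (-lam * s) * Real.exp (lam * s)) * a s
        - lam * (Real.exp (-lam * s) * ∫ x in (0:ℝ)..s, Real.exp (lam * x) * a x) := by ring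
    _ = _ := by rw [he, one_mul]

/-- Continuity of the Duhamel response. [folklore] -/
private theorem continuous_duhamel {a : ℝ → ℝ} (ha : Continuous a) (lam : ℝ) :
    Continuous fun s => Real.exp (-lam * s) * ∫ x in (0:ℝ)..s, Real.exp (lam * x) * a x :=
  continuous_iff_continuousAt.2 fun s => (hasDerivAt_duhamel ha lam s).continuousAt

/-- `0 ≤ J(s)` for `s ≥ 0` and a nonnegative envelope. [cite: MajdaKramer1999, §2.2.1.3] -/
theorem duhamel_nonneg {a : ℝ → ℝ} (ha0 : ∀ x, 0 ≤ a x) {lam s : ℝ}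
    (hs : 0 ≤ s) : 0 ≤ Real.exp (-lam * s) * ∫ x in (0:ℝ)..s, Real.exp (lam * x) * a x :=
  mul_nonneg (Real.exp_pos _).le
    (intervalIntegral.integral_nonneg hs fun x _ => mul_nonneg (Real.exp_pos _).le (ha0 x))

/-- `∫ₐᵇ e^{λx} dx = (e^{λb} − e^{λa})/λ`. [folklore] -/
private theorem integral_exp_const_mul {lam : ℝ} (hlam : lam ≠ 0) (a b : ℝ) :
    ∫ x in a..b, Real.exp (lam * x) = (Real.exp (lam * b) - Real.exp (lam * a)) / lam := by
  have hF : ∀ x ∈ uIcc a b, HasDerivAt (fun y => Real.exp (lam * y) / lam) (Real.exp (lam * x)) x := by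
    intro x _
    have h := (((hasDerivAt_id x).const_mul lam).exp).div_const lam
    simp only [id, mul_one] at h
    exact h.congr_deriv (by field_simp)
  rw [intervalIntegral.integral_eq_sub_of_hasDerivAt hF
    ((by fun_prop : Continuous fun x => Real.exp (lam * x)).intervalIntegrable _ _)]
  ring

/-- `J(s) ≤ 1/λ` for `s ≥ 0`, `λ > 0` and an envelope `a ≤ 1` (indeed `J ≤ (1 − e^{−λs})/λ`).
[cite: MajdaKramer1999, §2.2.1.3] -/
theorem duhamel_le {a : ℝ → ℝ} (ha : Continuous a) (ha1 : ∀ x, a x ≤ 1) {lam : ℝ} (hlam : 0 < lam)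
    {s : ℝ} (hs : 0 ≤ s) :
    Real.exp (-lam * s) * ∫ x in (0:ℝ)..s, Real.exp (lam * x) * a x ≤ 1 / lam := by
  have h1 : ∫ x in (0:ℝ)..s, Real.exp (lam * x) * a x ≤ ∫ x in (0:ℝ)..s, Real.exp (lam * x) := by
    refine intervalIntegral.integral_mono_on hs ?_ ?_ fun x _ => ?_
    · exact (by fun_prop : Continuous fun x => Real.exp (lam * x) * a x).intervalIntegrable _ _
    · exact (by fun_prop : Continuous fun x => Real.exp (lam * x)).intervalIntegrable _ _
    · exact mul_le_of_le_one_right (Real.exp_pos _).le (ha1 x)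
  rw [integral_exp_const_mul hlam.ne', mul_zero, Real.exp_zero] at h1
  have he : Real.exp (-lam * s) * Real.exp (lam * s) = 1 := by rw [← Real.exp_add]; simp
  have hexp : 0 < Real.exp (-lam * s) := Real.exp_pos _
  calc Real.exp (-lam * s) * ∫ x in (0:ℝ)..s, Real.exp (lam * x) * a x
      ≤ Real.exp (-lam * s) * ((Real.exp (lam * s) - 1) / lam) :=
        mul_le_mul_of_nonneg_left h1 hexp.le
    _ = (1 - Real.exp (-lam * s)) / lam := by
        rw [mul_div_assoc', mul_sub, he, mul_one]
    _ ≤ 1 / lam := by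
        apply div_le_div_of_nonneg_right _ hlam.le
        linarith [hexp.le]

/-- **Upper law (kernel symbol `≤ 1`)**: for every continuous envelope `a` (any sign), `λ > 0`, `τ ≥ 0`,
`λ∫₀^τ a(s)·J(s) ds ≤ ∫₀^τ a(s)² ds` with `J(s) = ∫₀ˢ e^{−λ(s−x)}a(x)dx`. (Majda–Kramer: each temporal
mode of the envelope contributes its Taylor constant depleted by `λ²/(λ²+ω²) ≤ 1`; here without Fourier
analysis: AM–GM inside the kernel and `λ∫₀^τ J[a²] = ∫₀^τ a² − J[a²](τ) ≤ ∫₀^τ a²`.)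
[cite: MajdaKramer1999, §2.2.1.3 (55)] -/
theorem mul_integral_duhamel_le_integral_sq {a : ℝ → ℝ} (ha : Continuous a) {lam : ℝ}
    (hlam : 0 < lam) {τ : ℝ} (hτ : 0 ≤ τ) :
    lam * ∫ s in (0:ℝ)..τ, a s * (Real.exp (-lam * s) * ∫ x in (0:ℝ)..s, Real.exp (lam * x) * a x)
      ≤ ∫ s in (0:ℝ)..τ, a s ^ 2 := by
  set J : ℝ → ℝ := fun s => Real.exp (-lam * s) * ∫ x in (0:ℝ)..s, Real.exp (lam * x) * a x with hJ
  set J₂ : ℝ → ℝ := fun s => Real.exp (-lam * s) * ∫ x in (0:ℝ)..s, Real.exp (lam * x) * (a x ^ 2)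
    with hJ₂
  have ha2 : Continuous fun x => a x ^ 2 := ha.pow 2
  have hJc : Continuous J := continuous_duhamel ha lam
  have hJ₂c : Continuous J₂ := continuous_duhamel ha2 lam
  -- pointwise AM–GM inside the kernel
  have hpt : ∀ s ∈ Icc (0:ℝ) τ, a s * J s ≤ a s ^ 2 / (2 * lam) + J₂ s / 2 := by
    intro s hs
    have hs0 : 0 ≤ s := hs.1
    have hexp : 0 < Real.exp (-lam * s) := Real.exp_pos _
    have h1 : a s * J s = Real.exp (-lam * s) * ∫ x in (0:ℝ)..s, Real.exp (lam * x) * (a s * a x) := by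
      simp only [hJ]
      rw [← mul_assoc, mul_comm (a s), mul_assoc, ← intervalIntegral.integral_const_mul]
      congr 1
      exact intervalIntegral.integral_congr fun x _ => by ring
    have h2 : ∫ x in (0:ℝ)..s, Real.exp (lam * x) * (a s * a x)
        ≤ ∫ x in (0:ℝ)..s, (a s ^ 2 / 2 * Real.exp (lam * x) + Real.exp (lam * x) * (a x ^ 2) / 2) := by
      refine intervalIntegral.integral_mono_on hs0 ?_ ?_ fun x _ => ?_
      · exact (by fun_prop : Continuous fun x => Real.exp (lam * x) * (a s * a x)).intervalIntegrable _ _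
      · exact (by fun_prop : Continuous fun x =>
          a s ^ 2 / 2 * Real.exp (lam * x) + Real.exp (lam * x) * (a x ^ 2) / 2).intervalIntegrable _ _
      · nlinarith [Real.exp_pos (lam * x), sq_nonneg (a s - a x)]
    have h3 : ∫ x in (0:ℝ)..s, (a s ^ 2 / 2 * Real.exp (lam * x) + Real.exp (lam * x) * (a x ^ 2) / 2)
        = a s ^ 2 / 2 * ((Real.exp (lam * s) - 1) / lam)
          + (∫ x in (0:ℝ)..s, Real.exp (lam * x) * (a x ^ 2)) / 2 := by
      rw [intervalIntegral.integral_add, intervalIntegral.integral_const_mul,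
        integral_exp_const_mul hlam.ne', intervalIntegral.integral_div, mul_zero, Real.exp_zero]
      · exact (by fun_prop : Continuous fun x => a s ^ 2 / 2 * Real.exp (lam * x)).intervalIntegrable _ _
      · exact (by fun_prop : Continuous fun x =>
          Real.exp (lam * x) * (a x ^ 2) / 2).intervalIntegrable _ _
    have he : Real.exp (-lam * s) * Real.exp (lam * s) = 1 := by rw [← Real.exp_add]; simp
    have h4 : Real.exp (-lam * s) * (a s ^ 2 / 2 * ((Real.exp (lam * s) - 1) / lam))
        = a s ^ 2 / (2 * lam) * (1 - Real.exp (-lam * s)) := by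
      calc Real.exp (-lam * s) * (a s ^ 2 / 2 * ((Real.exp (lam * s) - 1) / lam))
          = a s ^ 2 / (2 * lam) * (Real.exp (-lam * s) * Real.exp (lam * s) - Real.exp (-lam * s)) := by
            ring
        _ = _ := by rw [he]
    have h5 : a s ^ 2 / (2 * lam) * (1 - Real.exp (-lam * s)) ≤ a s ^ 2 / (2 * lam) :=
      mul_le_of_le_one_right (by positivity) (by linarith [hexp.le])
    calc a s * J s = Real.exp (-lam * s) * ∫ x in (0:ℝ)..s, Real.exp (lam * x) * (a s * a x) := h1
      _ ≤ Real.exp (-lam * s) * ∫ x in (0:ℝ)..s,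
            (a s ^ 2 / 2 * Real.exp (lam * x) + Real.exp (lam * x) * (a x ^ 2) / 2) :=
          mul_le_mul_of_nonneg_left h2 hexp.le
      _ = a s ^ 2 / (2 * lam) * (1 - Real.exp (-lam * s)) + J₂ s / 2 := by
          rw [h3, mul_add, h4]
          simp only [hJ₂]
          ring
      _ ≤ a s ^ 2 / (2 * lam) + J₂ s / 2 := by linarith
  -- integrate the pointwise bound
  have hI : IntervalIntegrable (fun s => a s * J s) volume 0 τ := (ha.mul hJc).intervalIntegrable _ _
  have hI2 : IntervalIntegrable (fun s => a s ^ 2 / (2 * lam) + J₂ s / 2) volume 0 τ :=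
    ((ha2.div_const _).add (hJ₂c.div_const _)).intervalIntegrable _ _
  have h6 : ∫ s in (0:ℝ)..τ, a s * J s ≤ (∫ s in (0:ℝ)..τ, a s ^ 2) / (2 * lam)
      + (∫ s in (0:ℝ)..τ, J₂ s) / 2 := by
    have := intervalIntegral.integral_mono_on hτ hI hI2 hpt
    rwa [intervalIntegral.integral_add ((ha2.div_const _).intervalIntegrable _ _)
      ((hJ₂c.div_const _).intervalIntegrable _ _), intervalIntegral.integral_div,
      intervalIntegral.integral_div] at this
  -- `λ∫J₂ = ∫a² − J₂(τ) ≤ ∫a²`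
  have h7 : lam * ∫ s in (0:ℝ)..τ, J₂ s ≤ ∫ s in (0:ℝ)..τ, a s ^ 2 := by
    have hd : ∀ s ∈ uIcc (0:ℝ) τ, HasDerivAt J₂ (a s ^ 2 - lam * J₂ s) s := fun s _ =>
      hasDerivAt_duhamel ha2 lam s
    have hlJ : Continuous fun y => lam * J₂ y := continuous_const.mul hJ₂c
    have hftc := intervalIntegral.integral_eq_sub_of_hasDerivAt hd
      ((ha2.sub hlJ).intervalIntegrable _ _)
    rw [intervalIntegral.integral_sub (ha2.intervalIntegrable _ _) (hlJ.intervalIntegrable _ _),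
      intervalIntegral.integral_const_mul] at hftc
    have hJ₂0 : J₂ 0 = 0 := by simp [hJ₂]
    have hJ₂τ : 0 ≤ J₂ τ := duhamel_nonneg (fun x => sq_nonneg (a x)) hτ
    linarith
  have h8 := mul_le_mul_of_nonneg_left h6 hlam.le
  have e1 : lam * ((∫ s in (0:ℝ)..τ, a s ^ 2) / (2 * lam)) = (∫ s in (0:ℝ)..τ, a s ^ 2) / 2 := by
    field_simp
  rw [mul_add, e1] at h8
  linarith

end Duhamel

section Trapezoid

/-! ### The trapezoid envelope `LatticeWord.trapezoid 0 τ ρ` (ramps of length `ρτ`, `0 < ρ ≤ 1/2`) -/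

/-- On the up-ramp `[0, ρτ]` the trapezoid equals `s/(ρτ)`. [cite: ArmstrongVicol2025, §4 p. 17 (time cutoff)] -/
theorem trapezoid_eq_of_mem_ramp_up {τ ρ s : ℝ} (hτ : 0 < τ) (hρ : 0 < ρ) (hρ2 : ρ ≤ 1 / 2)
    (hs : s ∈ Icc 0 (ρ * τ)) : LatticeWord.trapezoid 0 τ ρ s = s / (ρ * τ) := by
  have hr : 0 < ρ * τ := mul_pos hρ hτ
  unfold LatticeWord.trapezoid
  have h1 : s / (ρ * τ) ≤ 1 := by rw [div_le_one hr]; exact hs.2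
  have h2 : s / (ρ * τ) ≤ (0 + τ - s) / (ρ * τ) := by
    apply div_le_div_of_nonneg_right _ hr.le
    nlinarith [hs.2]
  have h3 : 0 ≤ s / (ρ * τ) := div_nonneg hs.1 hr.le
  rw [sub_zero, min_eq_left h2, min_eq_right h1, max_eq_right h3]

/-- On the plateau `[ρτ, τ − ρτ]` the trapezoid equals `1`. [cite: ArmstrongVicol2025, §4 p. 17 (time cutoff)] -/
theorem trapezoid_eq_of_mem_plateau {τ ρ s : ℝ} (hτ : 0 < τ) (hρ : 0 < ρ)
    (hs : s ∈ Icc (ρ * τ) (τ - ρ * τ)) : LatticeWord.trapezoid 0 τ ρ s = 1 := by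
  have hr : 0 < ρ * τ := mul_pos hρ hτ
  unfold LatticeWord.trapezoid
  have h1 : 1 ≤ s / (ρ * τ) := by rw [le_div_iff₀ hr]; linarith [hs.1]
  have h2 : 1 ≤ (0 + τ - s) / (ρ * τ) := by rw [le_div_iff₀ hr]; linarith [hs.2]
  rw [sub_zero, min_eq_left (le_min h1 h2), max_eq_right zero_le_one]

/-- On the down-ramp `[τ − ρτ, τ]` the trapezoid equals `(τ − s)/(ρτ)`. [cite: ArmstrongVicol2025, §4 p. 17 (time cutoff)] -/
theorem trapezoid_eq_of_mem_ramp_down {τ ρ s : ℝ} (hτ : 0 < τ) (hρ : 0 < ρ) (hρ2 : ρ ≤ 1 / 2)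
    (hs : s ∈ Icc (τ - ρ * τ) τ) : LatticeWord.trapezoid 0 τ ρ s = (τ - s) / (ρ * τ) := by
  have hr : 0 < ρ * τ := mul_pos hρ hτ
  unfold LatticeWord.trapezoid
  have h1 : (0 + τ - s) / (ρ * τ) ≤ 1 := by rw [div_le_one hr]; linarith [hs.1]
  have h2 : (0 + τ - s) / (ρ * τ) ≤ s / (ρ * τ) := by
    apply div_le_div_of_nonneg_right _ hr.le
    nlinarith [hs.1]
  have h3 : 0 ≤ (0 + τ - s) / (ρ * τ) := div_nonneg (by linarith [hs.2]) hr.le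
  rw [sub_zero, min_eq_right h2, min_eq_right h1, max_eq_right h3, zero_add]

/-- The trapezoid is continuous. [folklore] -/
private theorem continuous_trapezoid' (τ ρ : ℝ) : Continuous fun s => LatticeWord.trapezoid 0 τ ρ s := by
  unfold LatticeWord.trapezoid; fun_prop

/-- `0 ≤ trapezoid ≤ 1`. [folklore] -/
private theorem trapezoid_mem_Icc (τ ρ s : ℝ) : LatticeWord.trapezoid 0 τ ρ s ∈ Icc (0:ℝ) 1 := by
  unfold LatticeWord.trapezoid
  exact ⟨le_max_left _ _, max_le zero_le_one (min_le_left _ _)⟩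

/-- **`∫₀^τ trapezoid² = τ(1 − 4ρ/3)`** — the envelope factor `⨍a² = 1 − 4ρ/3` of the `slotGain`
docstring (`= 1/3` for the triangle `ρ = 1/2`; kit j272729). [cite: ArmstrongVicol2025, §4 p. 17 (∫ζ² = 9/10)] -/
theorem integral_trapezoid_sq {τ ρ : ℝ} (hτ : 0 < τ) (hρ : 0 < ρ) (hρ2 : ρ ≤ 1 / 2) :
    ∫ s in (0:ℝ)..τ, LatticeWord.trapezoid 0 τ ρ s ^ 2 = τ * (1 - 4 * ρ / 3) := by
  have hr : 0 < ρ * τ := mul_pos hρ hτ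
  set r := ρ * τ with hrdef
  have hr2 : r ≤ τ - r := by rw [hrdef]; nlinarith
  have hcont := continuous_trapezoid' τ ρ
  have hint : ∀ a b : ℝ, IntervalIntegrable (fun s => LatticeWord.trapezoid 0 τ ρ s ^ 2) volume a b :=
    fun a b => (hcont.pow 2).intervalIntegrable a b
  -- split `[0, τ] = [0, r] ∪ [r, τ − r] ∪ [τ − r, τ]`
  rw [← intervalIntegral.integral_add_adjacent_intervals (hint 0 r) (hint r τ),
    ← intervalIntegral.integral_add_adjacent_intervals (hint r (τ - r)) (hint (τ - r) τ)]
  -- piece 1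
  have h1 : ∫ s in (0:ℝ)..r, LatticeWord.trapezoid 0 τ ρ s ^ 2 = r / 3 := by
    rw [intervalIntegral.integral_congr (g := fun s => (s / r) ^ 2) (fun s hs => by
      rw [uIcc_of_le hr.le] at hs
      simp only; rw [trapezoid_eq_of_mem_ramp_up hτ hρ hρ2 hs])]
    have hF : ∀ x ∈ uIcc (0:ℝ) r, HasDerivAt (fun s => s ^ 3 / (3 * r ^ 2)) ((x / r) ^ 2) x := by
      intro x _
      have h := ((hasDerivAt_id x).pow 3).div_const (3 * r ^ 2)
      simp only [id] at h
      refine h.congr_deriv ?_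
      field_simp; ring
    rw [intervalIntegral.integral_eq_sub_of_hasDerivAt hF
      ((by fun_prop : Continuous fun x : ℝ => (x / r) ^ 2).intervalIntegrable _ _)]
    field_simp; ring
  -- piece 2
  have h2 : ∫ s in r..(τ - r), LatticeWord.trapezoid 0 τ ρ s ^ 2 = τ - 2 * r := by
    rw [intervalIntegral.integral_congr (g := fun _ => (1:ℝ)) (fun s hs => by
      rw [uIcc_of_le hr2] at hs
      simp only; rw [trapezoid_eq_of_mem_plateau hτ hρ hs, one_pow])]
    simp; ring
  -- piece 3
  have h3 : ∫ s in (τ - r)..τ, LatticeWord.trapezoid 0 τ ρ s ^ 2 = r / 3 := by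
    rw [intervalIntegral.integral_congr (g := fun s => ((τ - s) / r) ^ 2) (fun s hs => by
      rw [uIcc_of_le (by linarith : τ - r ≤ τ)] at hs
      simp only; rw [trapezoid_eq_of_mem_ramp_down hτ hρ hρ2 hs])]
    have hF : ∀ x ∈ uIcc (τ - r) τ, HasDerivAt (fun s => -(τ - s) ^ 3 / (3 * r ^ 2))
        (((τ - x) / r) ^ 2) x := by
      intro x _
      have h := (((hasDerivAt_id x).const_sub τ).pow 3).neg.div_const (3 * r ^ 2)
      simp only [id] at h
      refine h.congr_deriv ?_
      field_simp; ring
    rw [intervalIntegral.integral_eq_sub_of_hasDerivAt hF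
      ((by fun_prop : Continuous fun x : ℝ => ((τ - x) / r) ^ 2).intervalIntegrable _ _)]
    field_simp; ring
  rw [h1, h2, h3, hrdef]; ring

/-- **Exact identity for the realised slot weight of the trapezoid.** With `a = trapezoid 0 τ ρ`
(`0 < ρ ≤ 1/2`, `τ > 0`), `λ > 0` and `J(s) = ∫₀ˢ e^{−λ(s−x)}a(x)dx`:
`λ∫₀^τ a(s)J(s) ds = τ(1 − 4ρ/3) − (J(ρτ) + J(τ − ρτ) − J(τ))/(ρτλ)`.
(From `λJ = a − J′`: `λ∫aJ = ∫a² − ∫aJ′`; integrating by parts on the three affine pieces, the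
boundary terms telescope to `0`, `∫ a a′ = 0` kills the two `O(1/λ)` ramp terms, and
`∫_piece J = (∫_piece a − ΔJ)/λ` leaves only the corner values of `J`.)
[cite: MajdaKramer1999, §2.2.1.3 (55) (quasi-static limit τ_T → ∞ and its depletion)] -/
theorem mul_integral_trapezoid_duhamel_eq {τ ρ lam : ℝ} (hτ : 0 < τ) (hρ : 0 < ρ) (hρ2 : ρ ≤ 1 / 2)
    (hlam : 0 < lam) :
    lam * ∫ s in (0:ℝ)..τ, LatticeWord.trapezoid 0 τ ρ s *
        (Real.exp (-lam * s) * ∫ x in (0:ℝ)..s, Real.exp (lam * x) * LatticeWord.trapezoid 0 τ ρ x)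
      = τ * (1 - 4 * ρ / 3)
        - ((Real.exp (-lam * (ρ * τ)) * ∫ x in (0:ℝ)..(ρ * τ),
              Real.exp (lam * x) * LatticeWord.trapezoid 0 τ ρ x)
          + (Real.exp (-lam * (τ - ρ * τ)) * ∫ x in (0:ℝ)..(τ - ρ * τ),
              Real.exp (lam * x) * LatticeWord.trapezoid 0 τ ρ x)
          - (Real.exp (-lam * τ) * ∫ x in (0:ℝ)..τ,
              Real.exp (lam * x) * LatticeWord.trapezoid 0 τ ρ x)) / (ρ * τ * lam) := by
  have hr : 0 < ρ * τ := mul_pos hρ hτ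
  set r := ρ * τ with hrdef
  have hr2 : r ≤ τ - r := by rw [hrdef]; nlinarith
  have hr3 : τ - r ≤ τ := by linarith
  set a : ℝ → ℝ := fun s => LatticeWord.trapezoid 0 τ ρ s with hadef
  set J : ℝ → ℝ := fun s => Real.exp (-lam * s) * ∫ x in (0:ℝ)..s, Real.exp (lam * x) * a x with hJ
  have hac : Continuous a := continuous_trapezoid' τ ρ
  have hJd : ∀ s, HasDerivAt J (a s - lam * J s) s := fun s => hasDerivAt_duhamel hac lam s
  have hJc : Continuous J := continuous_duhamel hac lam
  set J' : ℝ → ℝ := fun s => a s - lam * J s with hJ'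
  have hJ'c : Continuous J' := hac.sub (continuous_const.mul hJc)
  have hJ0 : J 0 = 0 := by simp [hJ]
  -- Step A: `λ∫aJ = ∫a² − ∫aJ′`
  have i1 : IntervalIntegrable (fun s => a s ^ 2) volume 0 τ := (hac.pow 2).intervalIntegrable _ _
  have i2 : IntervalIntegrable (fun s => a s * J' s) volume 0 τ := (hac.mul hJ'c).intervalIntegrable _ _
  have hlJc : Continuous fun s => lam * J s := continuous_const.mul hJc
  have hA : lam * ∫ s in (0:ℝ)..τ, a s * J s
      = (∫ s in (0:ℝ)..τ, a s ^ 2) - ∫ s in (0:ℝ)..τ, a s * J' s := by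
    rw [← intervalIntegral.integral_const_mul, ← intervalIntegral.integral_sub i1 i2]
    exact intervalIntegral.integral_congr fun s _ => by simp only [hJ']; ring
  -- Step C: `∫_α^β J = (∫_α^β a − (J β − J α))/λ`
  have hC : ∀ α β : ℝ, ∫ s in α..β, J s = ((∫ s in α..β, a s) - (J β - J α)) / lam := by
    intro α β
    have hftc := intervalIntegral.integral_eq_sub_of_hasDerivAt (fun s _ => hJd s)
      (hJ'c.intervalIntegrable α β)
    have : ∫ s in α..β, a s - lam * J s = (∫ s in α..β, a s) - lam * ∫ s in α..β, J s := by
      rw [intervalIntegral.integral_sub (hac.intervalIntegrable _ _) (hlJc.intervalIntegrable _ _),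
        intervalIntegral.integral_const_mul]
    rw [this] at hftc
    field_simp
    linarith
  -- Step B: piecewise integration by parts of `∫ a J′`
  have hIBP : ∀ (α β c d : ℝ), α ≤ β → (∀ s ∈ Icc α β, a s = c * s + d) →
      ∫ s in α..β, a s * J' s = (c * β + d) * J β - (c * α + d) * J α - c * ∫ s in α..β, J s := by
    intro α β c d hαβ haff
    rw [intervalIntegral.integral_congr (g := fun s => (c * s + d) * J' s) (fun s hs => by
      rw [uIcc_of_le hαβ] at hs; simp only; rw [haff s hs])]
    have hu : ∀ x ∈ uIcc α β, HasDerivAt (fun s => c * s + d) c x := fun x _ => by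
      have h := ((hasDerivAt_id x).const_mul c).add_const d
      simpa using h
    have h := intervalIntegral.integral_mul_deriv_eq_deriv_mul hu (fun x _ => hJd x)
      (continuous_const.intervalIntegrable _ _) (hJ'c.intervalIntegrable _ _)
    rw [h, intervalIntegral.integral_const_mul]
  have hB1 : ∫ s in (0:ℝ)..r, a s * J' s = J r - (1 / r) * ∫ s in (0:ℝ)..r, J s := by
    rw [hIBP 0 r (1 / r) 0 hr.le (fun s hs => by
      simp only [hadef]; rw [trapezoid_eq_of_mem_ramp_up hτ hρ hρ2 hs]; ring)]
    rw [one_div_mul_cancel hr.ne', hJ0]; ring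
  have hB2 : ∫ s in r..(τ - r), a s * J' s = J (τ - r) - J r := by
    rw [hIBP r (τ - r) 0 1 hr2 (fun s hs => by
      simp only [hadef]; rw [trapezoid_eq_of_mem_plateau hτ hρ hs]; ring)]
    ring
  have hB3 : ∫ s in (τ - r)..τ, a s * J' s = -J (τ - r) + (1 / r) * ∫ s in (τ - r)..τ, J s := by
    rw [hIBP (τ - r) τ (-(1 / r)) (τ / r) hr3 (fun s hs => by
      simp only [hadef]; rw [trapezoid_eq_of_mem_ramp_down hτ hρ hρ2 hs]; field_simp; ring)]
    have e1 : -(1 / r) * τ + τ / r = 0 := by ring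
    have e2 : -(1 / r) * (τ - r) + τ / r = 1 := by field_simp; ring
    rw [e1, e2]; ring
  -- the ramp integrals of `a`
  have hI1 : ∫ s in (0:ℝ)..r, a s = r / 2 := by
    rw [intervalIntegral.integral_congr (g := fun s => s / r) (fun s hs => by
      rw [uIcc_of_le hr.le] at hs; simp only [hadef]; rw [trapezoid_eq_of_mem_ramp_up hτ hρ hρ2 hs])]
    rw [intervalIntegral.integral_div, integral_id]; field_simp; ring
  have hI3 : ∫ s in (τ - r)..τ, a s = r / 2 := by
    rw [intervalIntegral.integral_congr (g := fun s => (τ - s) / r) (fun s hs => by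
      rw [uIcc_of_le hr3] at hs; simp only [hadef]; rw [trapezoid_eq_of_mem_ramp_down hτ hρ hρ2 hs])]
    rw [intervalIntegral.integral_div, intervalIntegral.integral_sub intervalIntegrable_const
      intervalIntegrable_id, intervalIntegral.integral_const, integral_id]
    simp only [smul_eq_mul]
    field_simp; ring
  -- assemble Step B
  have hB : ∫ s in (0:ℝ)..τ, a s * J' s = (J r + J (τ - r) - J τ) / (r * lam) := by
    have hint : ∀ α β : ℝ, IntervalIntegrable (fun s => a s * J' s) volume α β :=
      fun α β => (hac.mul hJ'c).intervalIntegrable α β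
    rw [← intervalIntegral.integral_add_adjacent_intervals (hint 0 r) (hint r τ),
      ← intervalIntegral.integral_add_adjacent_intervals (hint r (τ - r)) (hint (τ - r) τ),
      hB1, hB2, hB3, hC 0 r, hC (τ - r) τ, hI1, hI3, hJ0]
    field_simp
    ring
  -- conclude
  have hsq := integral_trapezoid_sq hτ hρ hρ2
  rw [hA, hB, hsq]

/-- **Two-sided law with explicit lag**: for the trapezoid envelope (`0 < ρ ≤ 1/2`, `τ > 0`) and
`λ > 0`, `|λ∫₀^τ a J − τ(1 − 4ρ/3)| ≤ 2/(ρτλ²)`; dividing by `τ`: the realised weight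
`ϑ(ρ,T) = (λ/τ)∫₀^τ aJ` satisfies `|ϑ(ρ,T) − (1 − 4ρ/3)| ≤ 2/(ρT²)`, `T = λτ` — the `O(T⁻²)` lag of the
`slotGain` docstring with an explicit constant (kit j272729: `0.33333 / 0.66666 / 0.93332` at
`ρ = 1/2, 1/4, 0.05`). [cite: MajdaKramer1999, §2.2.1.3 (55)] -/
theorem abs_mul_integral_trapezoid_duhamel_sub_le {τ ρ lam : ℝ} (hτ : 0 < τ) (hρ : 0 < ρ)
    (hρ2 : ρ ≤ 1 / 2) (hlam : 0 < lam) :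
    |lam * (∫ s in (0:ℝ)..τ, LatticeWord.trapezoid 0 τ ρ s *
        (Real.exp (-lam * s) * ∫ x in (0:ℝ)..s, Real.exp (lam * x) * LatticeWord.trapezoid 0 τ ρ x))
      - τ * (1 - 4 * ρ / 3)| ≤ 2 / (ρ * τ * lam ^ 2) := by
  rw [mul_integral_trapezoid_duhamel_eq hτ hρ hρ2 hlam]
  have hr : 0 < ρ * τ := mul_pos hρ hτ
  have hac : Continuous fun s => LatticeWord.trapezoid 0 τ ρ s := continuous_trapezoid' τ ρ
  have h0 : ∀ t, 0 ≤ t → 0 ≤ Real.exp (-lam * t) * ∫ x in (0:ℝ)..t,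
      Real.exp (lam * x) * LatticeWord.trapezoid 0 τ ρ x :=
    fun t ht => duhamel_nonneg (fun x => (trapezoid_mem_Icc τ ρ x).1) ht
  have h1 : ∀ t, 0 ≤ t → Real.exp (-lam * t) * ∫ x in (0:ℝ)..t,
      Real.exp (lam * x) * LatticeWord.trapezoid 0 τ ρ x ≤ 1 / lam :=
    fun t ht => duhamel_le hac (fun x => (trapezoid_mem_Icc τ ρ x).2) hlam ht
  have ha1 := h0 (ρ * τ) hr.le
  have ha2 := h1 (ρ * τ) hr.le
  have hb1 := h0 (τ - ρ * τ) (by nlinarith)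
  have hb2 := h1 (τ - ρ * τ) (by nlinarith)
  have hc1 := h0 τ hτ.le
  have hc2 := h1 τ hτ.le
  rw [sub_sub_cancel_left, abs_neg, abs_div, abs_of_pos (by positivity : 0 < ρ * τ * lam),
    div_le_div_iff₀ (by positivity) (by positivity)]
  have hkey : |(Real.exp (-lam * (ρ * τ)) * ∫ x in (0:ℝ)..(ρ * τ),
        Real.exp (lam * x) * LatticeWord.trapezoid 0 τ ρ x)
      + (Real.exp (-lam * (τ - ρ * τ)) * ∫ x in (0:ℝ)..(τ - ρ * τ),
        Real.exp (lam * x) * LatticeWord.trapezoid 0 τ ρ x)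
      - (Real.exp (-lam * τ) * ∫ x in (0:ℝ)..τ,
        Real.exp (lam * x) * LatticeWord.trapezoid 0 τ ρ x)| ≤ 2 / lam := by
    have hl : 0 < 1 / lam := by positivity
    have e : 2 / lam = 1 / lam + 1 / lam := by ring
    rw [abs_le, e]; constructor <;> linarith
  calc _ ≤ 2 / lam * (ρ * τ * lam ^ 2) := mul_le_mul_of_nonneg_right hkey (by positivity)
    _ = 2 * (ρ * τ * lam) := by rw [div_mul_eq_mul_div, div_eq_iff hlam.ne']; ring

/-- **Normalised form**: the realised slot weight `ϑ(ρ,T) := (λ/τ)∫₀^τ aJ` of the trapezoid obeys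
`|ϑ(ρ,T) − (1 − 4ρ/3)| ≤ 2/(ρτ²λ²) = 2/(ρT²)`, `T = λτ`. [cite: MajdaKramer1999, §2.2.1.3 (55)] -/
theorem abs_slotWeight_sub_le {τ ρ lam : ℝ} (hτ : 0 < τ) (hρ : 0 < ρ) (hρ2 : ρ ≤ 1 / 2)
    (hlam : 0 < lam) :
    |lam / τ * (∫ s in (0:ℝ)..τ, LatticeWord.trapezoid 0 τ ρ s *
        (Real.exp (-lam * s) * ∫ x in (0:ℝ)..s, Real.exp (lam * x) * LatticeWord.trapezoid 0 τ ρ x))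
      - (1 - 4 * ρ / 3)| ≤ 2 / (ρ * τ ^ 2 * lam ^ 2) := by
  have h := abs_mul_integral_trapezoid_duhamel_sub_le hτ hρ hρ2 hlam
  have hτ' : 0 < τ⁻¹ := inv_pos.2 hτ
  have e1 : lam / τ * (∫ s in (0:ℝ)..τ, LatticeWord.trapezoid 0 τ ρ s *
        (Real.exp (-lam * s) * ∫ x in (0:ℝ)..s, Real.exp (lam * x) * LatticeWord.trapezoid 0 τ ρ x))
      - (1 - 4 * ρ / 3)
      = τ⁻¹ * (lam * (∫ s in (0:ℝ)..τ, LatticeWord.trapezoid 0 τ ρ s *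
        (Real.exp (-lam * s) * ∫ x in (0:ℝ)..s, Real.exp (lam * x) * LatticeWord.trapezoid 0 τ ρ x))
        - τ * (1 - 4 * ρ / 3)) := by
    field_simp
  rw [e1, abs_mul, abs_of_pos hτ']
  calc τ⁻¹ * _ ≤ τ⁻¹ * (2 / (ρ * τ * lam ^ 2)) := mul_le_mul_of_nonneg_left h hτ'.le
    _ = 2 / (ρ * τ ^ 2 * lam ^ 2) := by field_simp

end Trapezoid

section Pair

/-! ### Inherited history and a same-direction PAIR of slots (STUB-PLAN r14 §4.2 «double hump»)

In the cubature word the two slots of a same-direction pair act on the SAME frequency ladder, so the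
Duhamel response in the second slot inherits the end value of the first. With
`g = c₁·trapezoid(0,τ₁,ρ) + c₂·trapezoid(τ₁,τ₂,ρ)` (`c₁, c₂` real of any sign — the prefactors
`(q̂·ê₁)`, `(q̂·ê₂)` of the two polarisations) and `a_i = trapezoid(0,τ_i,ρ)`:
`λ∫₀^{τ₁+τ₂} g J[g] = c₁²·λ∫₀^{τ₁} a₁J[a₁] + c₂²·λ∫₀^{τ₂} a₂J[a₂] + c₁c₂·λ·J[a₁](τ₁)·∫₀^{τ₂} a₂(u)e^{−λu}du`
EXACTLY (`mul_integral_pair_duhamel_eq`), and both factors of the cross term are `≤ 1/(ρτ_iλ²)`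
because the envelopes vanish linearly at the junction (`duhamel_trapezoid_end_le`,
`integral_trapezoid_mul_exp_neg_le`): the cross-hump term is `≤ |c₁c₂|/(ρ²τ₁τ₂λ³)` and the pair obeys
the two-sided law `abs_mul_integral_pair_duhamel_sub_le`. -/

/-- Translating a slot: `trapezoid a τ ρ s = trapezoid 0 τ ρ (s − a)`.
[cite: ArmstrongVicol2025, §4 p. 17 (time cutoff)] -/
theorem trapezoid_shift (a τ ρ s : ℝ) :
    LatticeWord.trapezoid a τ ρ s = LatticeWord.trapezoid 0 τ ρ (s - a) := by
  unfold LatticeWord.trapezoid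
  rw [sub_zero, zero_add, show a + τ - s = τ - (s - a) by ring]

/-- Up-ramp majorant, valid on the whole slot: `trapezoid 0 τ ρ s ≤ s/(ρτ)` for `s ≥ 0`.
[cite: ArmstrongVicol2025, §4 p. 17 (time cutoff)] -/
theorem trapezoid_le_div_of_nonneg {τ ρ s : ℝ} (hτ : 0 < τ) (hρ : 0 < ρ) (hs : 0 ≤ s) :
    LatticeWord.trapezoid 0 τ ρ s ≤ s / (ρ * τ) := by
  unfold LatticeWord.trapezoid
  rw [sub_zero]
  exact max_le (div_nonneg hs (mul_pos hρ hτ).le) (min_le_of_right_le (min_le_left _ _))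

/-- Down-ramp majorant, valid on the whole slot: `trapezoid 0 τ ρ s ≤ (τ − s)/(ρτ)` for `s ≤ τ`.
[cite: ArmstrongVicol2025, §4 p. 17 (time cutoff)] -/
theorem trapezoid_le_sub_div_of_le {τ ρ s : ℝ} (hτ : 0 < τ) (hρ : 0 < ρ) (hs : s ≤ τ) :
    LatticeWord.trapezoid 0 τ ρ s ≤ (τ - s) / (ρ * τ) := by
  unfold LatticeWord.trapezoid
  rw [zero_add]
  exact max_le (div_nonneg (by linarith) (mul_pos hρ hτ).le)
    (min_le_of_right_le (min_le_right _ _))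

/-- The slot envelope vanishes before the slot. [cite: ArmstrongVicol2025, §4 p. 17 (time cutoff)] -/
theorem trapezoid_eq_zero_of_nonpos {τ ρ s : ℝ} (hτ : 0 < τ) (hρ : 0 < ρ) (hs : s ≤ 0) :
    LatticeWord.trapezoid 0 τ ρ s = 0 := by
  unfold LatticeWord.trapezoid
  rw [sub_zero]
  exact max_eq_left (min_le_of_right_le (min_le_of_left_le
    (div_nonpos_of_nonpos_of_nonneg hs (mul_pos hρ hτ).le)))

/-- The slot envelope vanishes after the slot. [cite: ArmstrongVicol2025, §4 p. 17 (time cutoff)] -/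
theorem trapezoid_eq_zero_of_tau_le {τ ρ s : ℝ} (hτ : 0 < τ) (hρ : 0 < ρ) (hs : τ ≤ s) :
    LatticeWord.trapezoid 0 τ ρ s = 0 := by
  unfold LatticeWord.trapezoid
  rw [zero_add]
  exact max_eq_left (min_le_of_right_le (min_le_of_right_le
    (div_nonpos_of_nonpos_of_nonneg (by linarith) (mul_pos hρ hτ).le)))

/-- **Free decay after the envelope's support**: if `a = 0` on `[τ, s]` then `J(s) = e^{−λ(s−τ)}J(τ)`.
[cite: MajdaKramer1999, §2.2.1.3 (cell problem (49) with ∂χ/∂t)] -/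
theorem duhamel_eq_exp_mul_of_eq_zero {a : ℝ → ℝ} (ha : Continuous a) {lam τ s : ℝ} (hτs : τ ≤ s)
    (hz : ∀ x ∈ Icc τ s, a x = 0) :
    Real.exp (-lam * s) * ∫ x in (0:ℝ)..s, Real.exp (lam * x) * a x
      = Real.exp (-lam * (s - τ)) *
        (Real.exp (-lam * τ) * ∫ x in (0:ℝ)..τ, Real.exp (lam * x) * a x) := by
  have hcont : Continuous fun x => Real.exp (lam * x) * a x := by fun_prop
  have hsplit : ∫ x in (0:ℝ)..s, Real.exp (lam * x) * a x
      = (∫ x in (0:ℝ)..τ, Real.exp (lam * x) * a x) + ∫ x in τ..s, Real.exp (lam * x) * a x :=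
    (intervalIntegral.integral_add_adjacent_intervals (hcont.intervalIntegrable _ _)
      (hcont.intervalIntegrable _ _)).symm
  have hzero : ∫ x in τ..s, Real.exp (lam * x) * a x = 0 := by
    have h : EqOn (fun x => Real.exp (lam * x) * a x) (fun _ => 0) (uIcc τ s) := fun x hx => by
      rw [uIcc_of_le hτs] at hx
      simp [hz x hx]
    rw [intervalIntegral.integral_congr h]; simp
  rw [hsplit, hzero, add_zero, ← mul_assoc, ← Real.exp_add]
  congr 1; ring_nf

/-- `∫₀^τ u e^{−λu} du = (1 − (1 + λτ)e^{−λτ})/λ² ≤ 1/λ²`. [folklore] -/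
private theorem integral_id_mul_exp_neg_le {lam : ℝ} (hlam : 0 < lam) {τ : ℝ} (hτ : 0 ≤ τ) :
    ∫ u in (0:ℝ)..τ, u * Real.exp (-lam * u) ≤ 1 / lam ^ 2 := by
  have hl : lam ≠ 0 := hlam.ne'
  have hF : ∀ u ∈ uIcc 0 τ, HasDerivAt (fun u => -(u / lam + 1 / lam ^ 2) * Real.exp (-lam * u))
      (u * Real.exp (-lam * u)) u := by
    intro u _
    have h1 : HasDerivAt (fun u => -(u / lam + 1 / lam ^ 2)) (-(1 / lam)) u :=
      (((hasDerivAt_id u).div_const lam).add_const (1 / lam ^ 2)).neg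
    have h2 : HasDerivAt (fun u => Real.exp (-lam * u)) (-lam * Real.exp (-lam * u)) u := by
      have h := ((hasDerivAt_id u).const_mul (-lam)).exp
      simp only [id, mul_one] at h
      exact h.congr_deriv (by ring)
    refine (h1.mul h2).congr_deriv ?_
    field_simp
    ring
  rw [intervalIntegral.integral_eq_sub_of_hasDerivAt hF
    ((by fun_prop : Continuous fun u => u * Real.exp (-lam * u)).intervalIntegrable _ _)]
  have e0 : -((0:ℝ) / lam + 1 / lam ^ 2) * Real.exp (-lam * 0) = -(1 / lam ^ 2) := by simp
  rw [e0]
  have hpos : 0 ≤ (τ / lam + 1 / lam ^ 2) * Real.exp (-lam * τ) := by positivity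
  linarith

/-- **History overlap**: `∫₀^τ trapezoid(u)·e^{−λu} du ≤ 1/(ρτλ²)` — an envelope ramping up linearly
from `0` overlaps the free decay `e^{−λu}` of an inherited response only at second order.
[cite: MajdaKramer1999, §2.2.1.3 (55)] -/
theorem integral_trapezoid_mul_exp_neg_le {τ ρ lam : ℝ} (hτ : 0 < τ) (hρ : 0 < ρ) (hlam : 0 < lam) :
    ∫ u in (0:ℝ)..τ, LatticeWord.trapezoid 0 τ ρ u * Real.exp (-lam * u)
      ≤ 1 / (ρ * τ * lam ^ 2) := by
  have hr : 0 < ρ * τ := mul_pos hρ hτ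
  have h1 : ∫ u in (0:ℝ)..τ, LatticeWord.trapezoid 0 τ ρ u * Real.exp (-lam * u)
      ≤ ∫ u in (0:ℝ)..τ, (1 / (ρ * τ)) * (u * Real.exp (-lam * u)) := by
    refine intervalIntegral.integral_mono_on hτ.le ?_ ?_ fun u hu => ?_
    · exact ((continuous_trapezoid' τ ρ).mul (by fun_prop)).intervalIntegrable _ _
    · exact (by fun_prop : Continuous fun u : ℝ =>
        (1 / (ρ * τ)) * (u * Real.exp (-lam * u))).intervalIntegrable _ _
    · calc LatticeWord.trapezoid 0 τ ρ u * Real.exp (-lam * u)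
          ≤ u / (ρ * τ) * Real.exp (-lam * u) :=
            mul_le_mul_of_nonneg_right (trapezoid_le_div_of_nonneg hτ hρ hu.1) (Real.exp_pos _).le
        _ = (1 / (ρ * τ)) * (u * Real.exp (-lam * u)) := by ring
  rw [intervalIntegral.integral_const_mul] at h1
  calc _ ≤ (1 / (ρ * τ)) * ∫ u in (0:ℝ)..τ, u * Real.exp (-lam * u) := h1
    _ ≤ (1 / (ρ * τ)) * (1 / lam ^ 2) :=
        mul_le_mul_of_nonneg_left (integral_id_mul_exp_neg_le hlam hτ.le) (by positivity)
    _ = 1 / (ρ * τ * lam ^ 2) := by rw [one_div_mul_one_div]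

/-- **End value**: `J[trapezoid](τ) ≤ 1/(ρτλ²)` — the response a slot leaves behind after ramping
down linearly to `0` is second-order small. [cite: MajdaKramer1999, §2.2.1.3 (55)] -/
theorem duhamel_trapezoid_end_le {τ ρ lam : ℝ} (hτ : 0 < τ) (hρ : 0 < ρ) (hlam : 0 < lam) :
    Real.exp (-lam * τ) * ∫ x in (0:ℝ)..τ, Real.exp (lam * x) * LatticeWord.trapezoid 0 τ ρ x
      ≤ 1 / (ρ * τ * lam ^ 2) := by
  rw [exp_mul_integral_eq_duhamel]
  have hr : 0 < ρ * τ := mul_pos hρ hτ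
  have h1 : ∫ x in (0:ℝ)..τ, Real.exp (-lam * (τ - x)) * LatticeWord.trapezoid 0 τ ρ x
      ≤ ∫ x in (0:ℝ)..τ, (1 / (ρ * τ)) * ((τ - x) * Real.exp (-lam * (τ - x))) := by
    refine intervalIntegral.integral_mono_on hτ.le ?_ ?_ fun x hx => ?_
    · exact ((by fun_prop : Continuous fun x => Real.exp (-lam * (τ - x))).mul
        (continuous_trapezoid' τ ρ)).intervalIntegrable _ _
    · exact (by fun_prop : Continuous fun x : ℝ =>
        (1 / (ρ * τ)) * ((τ - x) * Real.exp (-lam * (τ - x)))).intervalIntegrable _ _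
    · calc Real.exp (-lam * (τ - x)) * LatticeWord.trapezoid 0 τ ρ x
          ≤ Real.exp (-lam * (τ - x)) * ((τ - x) / (ρ * τ)) :=
            mul_le_mul_of_nonneg_left (trapezoid_le_sub_div_of_le hτ hρ hx.2) (Real.exp_pos _).le
        _ = (1 / (ρ * τ)) * ((τ - x) * Real.exp (-lam * (τ - x))) := by ring
  have h2 : ∫ x in (0:ℝ)..τ, (1 / (ρ * τ)) * ((τ - x) * Real.exp (-lam * (τ - x)))
      = (1 / (ρ * τ)) * ∫ u in (0:ℝ)..τ, u * Real.exp (-lam * u) := by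
    rw [intervalIntegral.integral_const_mul]
    congr 1
    have h := intervalIntegral.integral_comp_sub_left (fun u => u * Real.exp (-lam * u)) τ
      (a := 0) (b := τ)
    rw [sub_self, sub_zero] at h
    exact h
  calc _ ≤ _ := h1
    _ = _ := h2
    _ ≤ (1 / (ρ * τ)) * (1 / lam ^ 2) :=
        mul_le_mul_of_nonneg_left (integral_id_mul_exp_neg_le hlam hτ.le) (by positivity)
    _ = 1 / (ρ * τ * lam ^ 2) := by rw [one_div_mul_one_div]

/-- Inner integral of the pair envelope inside the first slot (`0 ≤ s ≤ τ₁`): only the first envelope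
has acted. [folklore] -/
private theorem pair_inner_of_le {τ₁ τ₂ ρ lam : ℝ} (hτ₂ : 0 < τ₂) (hρ : 0 < ρ) (c₁ c₂ : ℝ)
    {s : ℝ} (hs0 : 0 ≤ s) (hs : s ≤ τ₁) :
    ∫ x in (0:ℝ)..s, Real.exp (lam * x) *
        (c₁ * LatticeWord.trapezoid 0 τ₁ ρ x + c₂ * LatticeWord.trapezoid τ₁ τ₂ ρ x)
      = c₁ * ∫ x in (0:ℝ)..s, Real.exp (lam * x) * LatticeWord.trapezoid 0 τ₁ ρ x := by
  rw [← intervalIntegral.integral_const_mul]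
  refine intervalIntegral.integral_congr fun x hx => ?_
  rw [uIcc_of_le hs0] at hx
  have hz : LatticeWord.trapezoid τ₁ τ₂ ρ x = 0 := by
    rw [trapezoid_shift]
    exact trapezoid_eq_zero_of_nonpos hτ₂ hρ (by linarith [hx.2])
  simp only [hz, mul_zero, add_zero]
  ring

/-- Inner integral of the pair envelope inside the second slot (`τ₁ ≤ s`): the first envelope has
finished, the second one is the translated `trapezoid(0,τ₂,ρ)`. [folklore] -/
private theorem pair_inner_of_ge {τ₁ τ₂ ρ lam : ℝ} (hτ₁ : 0 < τ₁) (hτ₂ : 0 < τ₂) (hρ : 0 < ρ)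
    (c₁ c₂ : ℝ) {s : ℝ} (hs : τ₁ ≤ s) :
    ∫ x in (0:ℝ)..s, Real.exp (lam * x) *
        (c₁ * LatticeWord.trapezoid 0 τ₁ ρ x + c₂ * LatticeWord.trapezoid τ₁ τ₂ ρ x)
      = c₁ * (∫ x in (0:ℝ)..τ₁, Real.exp (lam * x) * LatticeWord.trapezoid 0 τ₁ ρ x)
        + c₂ * (Real.exp (lam * τ₁) *
          ∫ u in (0:ℝ)..(s - τ₁), Real.exp (lam * u) * LatticeWord.trapezoid 0 τ₂ ρ u) := by
  have hc1 : Continuous fun x => Real.exp (lam * x) * LatticeWord.trapezoid 0 τ₁ ρ x :=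
    (by fun_prop : Continuous fun x => Real.exp (lam * x)).mul (continuous_trapezoid' τ₁ ρ)
  have hc2 : Continuous fun x => Real.exp (lam * x) * LatticeWord.trapezoid τ₁ τ₂ ρ x := by
    have h : Continuous fun x => LatticeWord.trapezoid τ₁ τ₂ ρ x := by
      unfold LatticeWord.trapezoid; fun_prop
    exact (by fun_prop : Continuous fun x => Real.exp (lam * x)).mul h
  -- linearity of the inner integral
  have hlin : ∫ x in (0:ℝ)..s, Real.exp (lam * x) *
        (c₁ * LatticeWord.trapezoid 0 τ₁ ρ x + c₂ * LatticeWord.trapezoid τ₁ τ₂ ρ x)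
      = c₁ * (∫ x in (0:ℝ)..s, Real.exp (lam * x) * LatticeWord.trapezoid 0 τ₁ ρ x)
        + c₂ * ∫ x in (0:ℝ)..s, Real.exp (lam * x) * LatticeWord.trapezoid τ₁ τ₂ ρ x := by
    rw [← intervalIntegral.integral_const_mul, ← intervalIntegral.integral_const_mul,
      ← intervalIntegral.integral_add ((hc1.intervalIntegrable _ _).const_mul _)
        ((hc2.intervalIntegrable _ _).const_mul _)]
    refine intervalIntegral.integral_congr fun x _ => ?_
    ring
  -- the first envelope has finished at `τ₁`
  have h1 : ∫ x in (0:ℝ)..s, Real.exp (lam * x) * LatticeWord.trapezoid 0 τ₁ ρ x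
      = ∫ x in (0:ℝ)..τ₁, Real.exp (lam * x) * LatticeWord.trapezoid 0 τ₁ ρ x := by
    rw [← intervalIntegral.integral_add_adjacent_intervals (b := τ₁)
      (hc1.intervalIntegrable _ _) (hc1.intervalIntegrable _ _)]
    have hz : ∫ x in τ₁..s, Real.exp (lam * x) * LatticeWord.trapezoid 0 τ₁ ρ x = 0 := by
      have h : EqOn (fun x => Real.exp (lam * x) * LatticeWord.trapezoid 0 τ₁ ρ x) (fun _ => 0)
          (uIcc τ₁ s) := fun x hx => by
        rw [uIcc_of_le hs] at hx
        simp [trapezoid_eq_zero_of_tau_le hτ₁ hρ hx.1]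
      rw [intervalIntegral.integral_congr h]; simp
    rw [hz, add_zero]
  -- the second envelope is the translate of `trapezoid 0 τ₂ ρ`
  have h2 : ∫ x in (0:ℝ)..s, Real.exp (lam * x) * LatticeWord.trapezoid τ₁ τ₂ ρ x
      = Real.exp (lam * τ₁) *
          ∫ u in (0:ℝ)..(s - τ₁), Real.exp (lam * u) * LatticeWord.trapezoid 0 τ₂ ρ u := by
    rw [← intervalIntegral.integral_add_adjacent_intervals (b := τ₁)
      (hc2.intervalIntegrable _ _) (hc2.intervalIntegrable _ _)]
    have hz : ∫ x in (0:ℝ)..τ₁, Real.exp (lam * x) * LatticeWord.trapezoid τ₁ τ₂ ρ x = 0 := by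
      have h : EqOn (fun x => Real.exp (lam * x) * LatticeWord.trapezoid τ₁ τ₂ ρ x) (fun _ => 0)
          (uIcc 0 τ₁) := fun x hx => by
        rw [uIcc_of_le hτ₁.le] at hx
        have hz' : LatticeWord.trapezoid τ₁ τ₂ ρ x = 0 := by
          rw [trapezoid_shift]
          exact trapezoid_eq_zero_of_nonpos hτ₂ hρ (by linarith [hx.2])
        simp [hz']
      rw [intervalIntegral.integral_congr h]; simp
    rw [hz, zero_add]
    have h := intervalIntegral.integral_comp_sub_right
      (fun u => Real.exp (lam * (u + τ₁)) * LatticeWord.trapezoid 0 τ₂ ρ u) τ₁ (a := τ₁) (b := s)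
    simp only [sub_self, sub_add_cancel] at h
    -- `h : ∫ x in τ₁..s, e^{λx}·trapezoid 0 τ₂ ρ (x − τ₁) = ∫ x in 0..s−τ₁, e^{λ(x+τ₁)}·trapezoid 0 τ₂ ρ x`
    have h' : ∫ x in τ₁..s, Real.exp (lam * x) * LatticeWord.trapezoid τ₁ τ₂ ρ x
        = ∫ x in τ₁..s, Real.exp (lam * x) * LatticeWord.trapezoid 0 τ₂ ρ (x - τ₁) :=
      intervalIntegral.integral_congr fun x _ => by simp only [trapezoid_shift τ₁ τ₂ ρ x]
    rw [h', h, ← intervalIntegral.integral_const_mul]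
    refine intervalIntegral.integral_congr fun x _ => ?_
    rw [mul_add, Real.exp_add]
    ring
  rw [hlin, h1, h2]

/-- **Exact decomposition for a same-direction pair** `g = c₁·trapezoid(0,τ₁,ρ) + c₂·trapezoid(τ₁,τ₂,ρ)`:
`λ∫₀^{τ₁+τ₂} gJ[g] = c₁²·λΘ(τ₁) + c₂²·λΘ(τ₂) + c₁c₂·λ·J[a₁](τ₁)·∫₀^{τ₂}a₂(u)e^{−λu}du` with
`a_i = trapezoid(0,τ_i,ρ)`, `Θ(τ_i) = ∫₀^{τ_i} a_iJ[a_i]` — the two humps contribute their own slot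
integrals, plus ONE cross term: the second ramp overlapping the free decay of the end value of the first.
[cite: MajdaKramer1999, §2.2.1.3 (55)] -/
theorem mul_integral_pair_duhamel_eq {τ₁ τ₂ ρ lam : ℝ} (hτ₁ : 0 < τ₁) (hτ₂ : 0 < τ₂) (hρ : 0 < ρ)
    (c₁ c₂ : ℝ) :
    lam * ∫ s in (0:ℝ)..(τ₁ + τ₂),
        (c₁ * LatticeWord.trapezoid 0 τ₁ ρ s + c₂ * LatticeWord.trapezoid τ₁ τ₂ ρ s) *
          (Real.exp (-lam * s) * ∫ x in (0:ℝ)..s, Real.exp (lam * x) *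
            (c₁ * LatticeWord.trapezoid 0 τ₁ ρ x + c₂ * LatticeWord.trapezoid τ₁ τ₂ ρ x))
      = c₁ ^ 2 * (lam * ∫ s in (0:ℝ)..τ₁, LatticeWord.trapezoid 0 τ₁ ρ s *
            (Real.exp (-lam * s) * ∫ x in (0:ℝ)..s, Real.exp (lam * x) * LatticeWord.trapezoid 0 τ₁ ρ x))
        + c₂ ^ 2 * (lam * ∫ s in (0:ℝ)..τ₂, LatticeWord.trapezoid 0 τ₂ ρ s *
            (Real.exp (-lam * s) * ∫ x in (0:ℝ)..s, Real.exp (lam * x) * LatticeWord.trapezoid 0 τ₂ ρ x))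
        + c₁ * c₂ * lam *
            (Real.exp (-lam * τ₁) *
              ∫ x in (0:ℝ)..τ₁, Real.exp (lam * x) * LatticeWord.trapezoid 0 τ₁ ρ x) *
            ∫ u in (0:ℝ)..τ₂, LatticeWord.trapezoid 0 τ₂ ρ u * Real.exp (-lam * u) := by
  -- continuity of the outer integrand (a product of continuous functions)
  have hB : Continuous fun x => LatticeWord.trapezoid τ₁ τ₂ ρ x := by
    unfold LatticeWord.trapezoid; fun_prop
  have hg : Continuous fun x =>
      c₁ * LatticeWord.trapezoid 0 τ₁ ρ x + c₂ * LatticeWord.trapezoid τ₁ τ₂ ρ x :=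
    ((continuous_trapezoid' τ₁ ρ).const_mul _).add (hB.const_mul _)
  have hJ : Continuous fun s => Real.exp (-lam * s) * ∫ x in (0:ℝ)..s, Real.exp (lam * x) *
      (c₁ * LatticeWord.trapezoid 0 τ₁ ρ x + c₂ * LatticeWord.trapezoid τ₁ τ₂ ρ x) :=
    continuous_duhamel hg lam
  have hI : ∀ a b : ℝ, IntervalIntegrable (fun s =>
      (c₁ * LatticeWord.trapezoid 0 τ₁ ρ s + c₂ * LatticeWord.trapezoid τ₁ τ₂ ρ s) *
        (Real.exp (-lam * s) * ∫ x in (0:ℝ)..s, Real.exp (lam * x) *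
          (c₁ * LatticeWord.trapezoid 0 τ₁ ρ x + c₂ * LatticeWord.trapezoid τ₁ τ₂ ρ x))) volume a b :=
    fun a b => (hg.mul hJ).intervalIntegrable a b
  -- split the outer integral at the junction `τ₁`
  rw [← intervalIntegral.integral_add_adjacent_intervals (b := τ₁) (hI _ _) (hI _ _)]
  -- first hump: only `a₁` acts
  have P1 : ∫ s in (0:ℝ)..τ₁,
        (c₁ * LatticeWord.trapezoid 0 τ₁ ρ s + c₂ * LatticeWord.trapezoid τ₁ τ₂ ρ s) *
          (Real.exp (-lam * s) * ∫ x in (0:ℝ)..s, Real.exp (lam * x) *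
            (c₁ * LatticeWord.trapezoid 0 τ₁ ρ x + c₂ * LatticeWord.trapezoid τ₁ τ₂ ρ x))
      = c₁ ^ 2 * ∫ s in (0:ℝ)..τ₁, LatticeWord.trapezoid 0 τ₁ ρ s *
            (Real.exp (-lam * s) *
              ∫ x in (0:ℝ)..s, Real.exp (lam * x) * LatticeWord.trapezoid 0 τ₁ ρ x) := by
    rw [← intervalIntegral.integral_const_mul]
    refine intervalIntegral.integral_congr fun s hs => ?_
    rw [uIcc_of_le hτ₁.le] at hs
    have hz : LatticeWord.trapezoid τ₁ τ₂ ρ s = 0 := by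
      rw [trapezoid_shift]
      exact trapezoid_eq_zero_of_nonpos hτ₂ hρ (by linarith [hs.2])
    simp only [pair_inner_of_le hτ₂ hρ c₁ c₂ hs.1 hs.2, hz, mul_zero, add_zero]
    ring
  -- second hump: `a₁` has finished (free decay of its end value), `a₂` is the translated trapezoid
  have P2 : ∫ s in τ₁..(τ₁ + τ₂),
        (c₁ * LatticeWord.trapezoid 0 τ₁ ρ s + c₂ * LatticeWord.trapezoid τ₁ τ₂ ρ s) *
          (Real.exp (-lam * s) * ∫ x in (0:ℝ)..s, Real.exp (lam * x) *
            (c₁ * LatticeWord.trapezoid 0 τ₁ ρ x + c₂ * LatticeWord.trapezoid τ₁ τ₂ ρ x))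
      = c₁ * c₂ * (Real.exp (-lam * τ₁) *
              ∫ x in (0:ℝ)..τ₁, Real.exp (lam * x) * LatticeWord.trapezoid 0 τ₁ ρ x) *
            (∫ u in (0:ℝ)..τ₂, LatticeWord.trapezoid 0 τ₂ ρ u * Real.exp (-lam * u))
        + c₂ ^ 2 * ∫ u in (0:ℝ)..τ₂, LatticeWord.trapezoid 0 τ₂ ρ u *
            (Real.exp (-lam * u) *
              ∫ x in (0:ℝ)..u, Real.exp (lam * x) * LatticeWord.trapezoid 0 τ₂ ρ x) := by
    -- write the integrand as a function of `s − τ₁`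
    set F : ℝ → ℝ := fun u =>
        c₁ * c₂ * (Real.exp (-lam * τ₁) *
            ∫ x in (0:ℝ)..τ₁, Real.exp (lam * x) * LatticeWord.trapezoid 0 τ₁ ρ x) *
          (LatticeWord.trapezoid 0 τ₂ ρ u * Real.exp (-lam * u))
        + c₂ ^ 2 * (LatticeWord.trapezoid 0 τ₂ ρ u *
          (Real.exp (-lam * u) *
            ∫ x in (0:ℝ)..u, Real.exp (lam * x) * LatticeWord.trapezoid 0 τ₂ ρ x)) with hFdef
    have hF : ∫ s in τ₁..(τ₁ + τ₂),
        (c₁ * LatticeWord.trapezoid 0 τ₁ ρ s + c₂ * LatticeWord.trapezoid τ₁ τ₂ ρ s) *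
          (Real.exp (-lam * s) * ∫ x in (0:ℝ)..s, Real.exp (lam * x) *
            (c₁ * LatticeWord.trapezoid 0 τ₁ ρ x + c₂ * LatticeWord.trapezoid τ₁ τ₂ ρ x))
        = ∫ s in τ₁..(τ₁ + τ₂), F (s - τ₁) := by
      refine intervalIntegral.integral_congr fun s hs => ?_
      rw [uIcc_of_le (by linarith)] at hs
      have hz : LatticeWord.trapezoid 0 τ₁ ρ s = 0 := trapezoid_eq_zero_of_tau_le hτ₁ hρ hs.1
      have e1 : Real.exp (-lam * s) = Real.exp (-lam * (s - τ₁)) * Real.exp (-lam * τ₁) := by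
        rw [← Real.exp_add]; ring_nf
      have e2 : Real.exp (-lam * τ₁) * Real.exp (lam * τ₁) = 1 := by
        rw [← Real.exp_add]; simp
      simp only [hFdef, pair_inner_of_ge hτ₁ hτ₂ hρ c₁ c₂ hs.1, hz, trapezoid_shift τ₁ τ₂ ρ s,
        mul_zero, zero_add, e1]
      linear_combination (c₂ ^ 2 * LatticeWord.trapezoid 0 τ₂ ρ (s - τ₁) *
        Real.exp (-lam * (s - τ₁)) *
        ∫ u in (0:ℝ)..(s - τ₁), Real.exp (lam * u) * LatticeWord.trapezoid 0 τ₂ ρ u) * e2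
    have hsub := intervalIntegral.integral_comp_sub_right F τ₁ (a := τ₁) (b := τ₁ + τ₂)
    rw [sub_self, add_sub_cancel_left] at hsub
    rw [hF, hsub]
    have hcA : Continuous fun u => LatticeWord.trapezoid 0 τ₂ ρ u * Real.exp (-lam * u) :=
      (continuous_trapezoid' τ₂ ρ).mul (by fun_prop)
    have hcB : Continuous fun u => LatticeWord.trapezoid 0 τ₂ ρ u * (Real.exp (-lam * u) *
        ∫ x in (0:ℝ)..u, Real.exp (lam * x) * LatticeWord.trapezoid 0 τ₂ ρ x) :=
      (continuous_trapezoid' τ₂ ρ).mul (continuous_duhamel (continuous_trapezoid' τ₂ ρ) lam)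
    simp only [hFdef]
    rw [intervalIntegral.integral_add ((hcA.intervalIntegrable _ _).const_mul _)
        ((hcB.intervalIntegrable _ _).const_mul _),
      intervalIntegral.integral_const_mul, intervalIntegral.integral_const_mul]
  rw [P1, P2]
  ring

/-- **Two-sided law for a same-direction pair with explicit lag** (`0 < ρ ≤ 1/2`, `τ₁, τ₂, λ > 0`,
real `c₁, c₂` of any sign):
`|λ∫₀^{τ₁+τ₂} gJ[g] − (c₁²τ₁ + c₂²τ₂)(1 − 4ρ/3)| ≤ 2c₁²/(ρτ₁λ²) + 2c₂²/(ρτ₂λ²) + |c₁c₂|/(ρ²τ₁τ₂λ³)` —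
each hump carries its own `O(T⁻²)` lag and the cross-hump term is third order (`duhamel_trapezoid_end_le`
× `integral_trapezoid_mul_exp_neg_le`). [cite: MajdaKramer1999, §2.2.1.3 (55)] -/
theorem abs_mul_integral_pair_duhamel_sub_le {τ₁ τ₂ ρ lam : ℝ} (hτ₁ : 0 < τ₁) (hτ₂ : 0 < τ₂)
    (hρ : 0 < ρ) (hρ2 : ρ ≤ 1 / 2) (hlam : 0 < lam) (c₁ c₂ : ℝ) :
    |lam * (∫ s in (0:ℝ)..(τ₁ + τ₂),
        (c₁ * LatticeWord.trapezoid 0 τ₁ ρ s + c₂ * LatticeWord.trapezoid τ₁ τ₂ ρ s) *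
          (Real.exp (-lam * s) * ∫ x in (0:ℝ)..s, Real.exp (lam * x) *
            (c₁ * LatticeWord.trapezoid 0 τ₁ ρ x + c₂ * LatticeWord.trapezoid τ₁ τ₂ ρ x)))
      - (c₁ ^ 2 * τ₁ + c₂ ^ 2 * τ₂) * (1 - 4 * ρ / 3)|
      ≤ 2 * c₁ ^ 2 / (ρ * τ₁ * lam ^ 2) + 2 * c₂ ^ 2 / (ρ * τ₂ * lam ^ 2)
        + |c₁ * c₂| / (ρ ^ 2 * τ₁ * τ₂ * lam ^ 3) := by
  rw [mul_integral_pair_duhamel_eq hτ₁ hτ₂ hρ c₁ c₂]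
  have h1 := abs_mul_integral_trapezoid_duhamel_sub_le hτ₁ hρ hρ2 hlam
  have h2 := abs_mul_integral_trapezoid_duhamel_sub_le hτ₂ hρ hρ2 hlam
  have hE := duhamel_trapezoid_end_le hτ₁ hρ hlam
  have hE0 : 0 ≤ Real.exp (-lam * τ₁) *
      ∫ x in (0:ℝ)..τ₁, Real.exp (lam * x) * LatticeWord.trapezoid 0 τ₁ ρ x :=
    duhamel_nonneg (fun x => (trapezoid_mem_Icc τ₁ ρ x).1) hτ₁.le
  have hO := integral_trapezoid_mul_exp_neg_le hτ₂ hρ hlam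
  have hO0 : 0 ≤ ∫ u in (0:ℝ)..τ₂, LatticeWord.trapezoid 0 τ₂ ρ u * Real.exp (-lam * u) :=
    intervalIntegral.integral_nonneg hτ₂.le fun u _ =>
      mul_nonneg (trapezoid_mem_Icc τ₂ ρ u).1 (Real.exp_pos _).le
  -- abbreviate the five scalars
  set X₁ := lam * ∫ s in (0:ℝ)..τ₁, LatticeWord.trapezoid 0 τ₁ ρ s *
      (Real.exp (-lam * s) * ∫ x in (0:ℝ)..s, Real.exp (lam * x) * LatticeWord.trapezoid 0 τ₁ ρ x)
    with hX₁
  set X₂ := lam * ∫ s in (0:ℝ)..τ₂, LatticeWord.trapezoid 0 τ₂ ρ s *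
      (Real.exp (-lam * s) * ∫ x in (0:ℝ)..s, Real.exp (lam * x) * LatticeWord.trapezoid 0 τ₂ ρ x)
    with hX₂
  set E := Real.exp (-lam * τ₁) *
      ∫ x in (0:ℝ)..τ₁, Real.exp (lam * x) * LatticeWord.trapezoid 0 τ₁ ρ x with hEdef
  set O := ∫ u in (0:ℝ)..τ₂, LatticeWord.trapezoid 0 τ₂ ρ u * Real.exp (-lam * u) with hOdef
  have hcross : |c₁ * c₂ * lam * E * O| ≤ |c₁ * c₂| / (ρ ^ 2 * τ₁ * τ₂ * lam ^ 3) := by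
    rw [abs_mul, abs_mul, abs_mul, abs_of_pos hlam, abs_of_nonneg hE0, abs_of_nonneg hO0]
    calc |c₁ * c₂| * lam * E * O ≤ |c₁ * c₂| * lam * (1 / (ρ * τ₁ * lam ^ 2)) * (1 / (ρ * τ₂ * lam ^ 2)) := by
          gcongr
      _ = |c₁ * c₂| / (ρ ^ 2 * τ₁ * τ₂ * lam ^ 3) := by
          field_simp
  have e : c₁ ^ 2 * X₁ + c₂ ^ 2 * X₂ + c₁ * c₂ * lam * E * O - (c₁ ^ 2 * τ₁ + c₂ ^ 2 * τ₂) * (1 - 4 * ρ / 3)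
      = c₁ ^ 2 * (X₁ - τ₁ * (1 - 4 * ρ / 3)) + c₂ ^ 2 * (X₂ - τ₂ * (1 - 4 * ρ / 3))
        + c₁ * c₂ * lam * E * O := by ring
  rw [e]
  calc _ ≤ |c₁ ^ 2 * (X₁ - τ₁ * (1 - 4 * ρ / 3)) + c₂ ^ 2 * (X₂ - τ₂ * (1 - 4 * ρ / 3))|
          + |c₁ * c₂ * lam * E * O| := abs_add_le _ _
    _ ≤ |c₁ ^ 2 * (X₁ - τ₁ * (1 - 4 * ρ / 3))| + |c₂ ^ 2 * (X₂ - τ₂ * (1 - 4 * ρ / 3))|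
          + |c₁ * c₂ * lam * E * O| := by gcongr; exact abs_add_le _ _
    _ ≤ c₁ ^ 2 * (2 / (ρ * τ₁ * lam ^ 2)) + c₂ ^ 2 * (2 / (ρ * τ₂ * lam ^ 2))
          + |c₁ * c₂| / (ρ ^ 2 * τ₁ * τ₂ * lam ^ 3) := by
        gcongr
        · rw [abs_mul, abs_of_nonneg (sq_nonneg c₁)]
          exact mul_le_mul_of_nonneg_left h1 (sq_nonneg c₁)
        · rw [abs_mul, abs_of_nonneg (sq_nonneg c₂)]
          exact mul_le_mul_of_nonneg_left h2 (sq_nonneg c₂)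
    _ = _ := by ring

end Pair

section PairFactorisation

/-- **Factorisation of the cross-slot kernel** (the memory response of two consecutive slots on one
line): for any envelopes `a` (first slot, length `L_s`) and `a′` (second slot, length `L_s′`) and any
rate `λ`, `∫₀^{L′}∫₀^{L} a′(t) a(t′) e^{−λ(t + (L − t′))} dt′ dt = (∫₀^{L′} a′(t) e^{−λt} dt)·
(∫₀^{L} a(t′) e^{−λ(L − t′)} dt′)` — the exponential `e^{−λ(t + L − t′)}` splits into the END
transform of the first slot and the START transform of the second (the structure of the cross term of
`mul_integral_pair_duhamel_eq`; no integrability is needed for the identity). Exactly the text of the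
K1L plan's `SlowGraph.PairFactorisation`. [cite: MajdaKramer1999, §2.2.1.3 (55)] -/
theorem integral_integral_mul_exp_pair_factor :
    ∀ (lam Ls Ls' : ℝ) (a a' : ℝ → ℝ), 0 < Ls → 0 < Ls' →
    IntervalIntegrable a volume 0 Ls → IntervalIntegrable a' volume 0 Ls' →
    ∫ t in (0:ℝ)..Ls', ∫ t' in (0:ℝ)..Ls, a' t * a t' * Real.exp (-(lam * (t + (Ls - t')))) =
      (∫ t in (0:ℝ)..Ls', a' t * Real.exp (-(lam * t))) *
        (∫ t' in (0:ℝ)..Ls, a t' * Real.exp (-(lam * (Ls - t')))) := by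
  intro lam Ls Ls' a a' _ _ _ _
  have hinner : ∀ t, ∫ t' in (0:ℝ)..Ls, a' t * a t' * Real.exp (-(lam * (t + (Ls - t')))) =
      (a' t * Real.exp (-(lam * t))) * ∫ t' in (0:ℝ)..Ls, a t' * Real.exp (-(lam * (Ls - t'))) := by
    intro t
    rw [← intervalIntegral.integral_const_mul]
    refine intervalIntegral.integral_congr fun t' _ => ?_
    show a' t * a t' * Real.exp (-(lam * (t + (Ls - t')))) =
      a' t * Real.exp (-(lam * t)) * (a t' * Real.exp (-(lam * (Ls - t'))))
    rw [show -(lam * (t + (Ls - t'))) = -(lam * t) + -(lam * (Ls - t')) by ring, Real.exp_add]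
    ring
  simp_rw [hinner]
  rw [intervalIntegral.integral_mul_const]

end PairFactorisation


end Literature.Analysis.FluidPDE.LatticeShear

end
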